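import Summits.HodgeConjecture.CorCM.MumfordTateRankTimesRealMultiplication
import Summits.HodgeConjecture.CorCM.MumfordTateRankSimpleThreefolds
import HarnessLib

/-!
# Cells of the Mumford–Tate-rank ladder from `Hg(A × S) = Hg(A) × Hg(S)` for `S` with real or quaternionic multiplication: every simple non-CM
# abelian surface (`t(A × S) + 1 = t(A) + t(S)`), `t(A × S_RM) = t(A) + 6`, `RM × RM′ = 13`, Ribet's class `t(A × S) = t(A) + 3 dim S`, cubic-field
# threefolds `t(A × T) = t(A) + 9`, `T × T′ = 19`

COR-CM (cell `pub-hodgecm2`, seat `b27` gen 47, count-neutral Mumford–Tate-rank ladder; theorems only, no definition, no named fact;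
UNCONDITIONAL — nothing here uses or asserts HC_CM).  `t(X) := dim MT(H¹X)`.  The rows `t(X) + 1 = t(A) + t(S)` of
`CorCM/MumfordTateRankTimesRealMultiplication` (Moonen–Zarhin Lemma (3.4) for a glued-`𝔰𝔩₂`-blocks factor: Murty type with `m = 1`, real
splitting / quaternion algebras), specialised:

* §3 SURFACES: **`mtRank_hodge_one_add_one_eq_add_of_isIsogenous_prod_simpleSurface_of_not_isOfCMType`** — `t(X) + 1 = t(A) + t(S)` for EVERY
  simple abelian surface `S` not of CM type (types I(1) `t(S) = 11` — `CorCM/MumfordTateRankTimesLowGeneric` —, I(2) `t(S) = 7`, II(1)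
  `t(S) = 4`) and any `A` with `Hom(A, S) = 0` (Moonen–Zarhin (5.4)); `mtRank_hodge_one_eq_add_six_of_isIsogenous_prod_rmSurface`
  (`t(A × S) = t(A) + 6`), `mtRank_hodge_one_eq_add_three_of_isIsogenous_prod_qmSurface` (`t(A × S) = t(A) + 3`);
  **`mtRank_hodge_one_eq_thirteen_of_isIsogenous_prod_rmSurfaces`** — two NON-ISOGENOUS simple abelian surfaces with real multiplication:
  `t = 13` (`Hg = R_{F/ℚ} SL₂ × R_{F′/ℚ} SL₂`; the cell the `Θ`-rigid engine of `CorCM/MumfordTateRankSurfaceTimesSurface` left at `≤ 13`), and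
  `mtRank_hodge_one_add_one_eq_add_of_isIsogenous_prod_simpleSurfaces_of_not_isOfCMType` — `t(S × S′) + 1 = t(S) + t(S′)` for every pair of
  non-isogenous simple non-CM surfaces (Moonen–Zarhin (5.5); the fourfold cells `7, 10, 13, 14, 17, 21` uniformly);
* §4 RIBET'S CLASS: `mtRank_hodge_one_eq_add_three_mul_dim_of_isIsogenous_prod_isTotallyReal` — `t(X) = t(A) + 3 dim S` for `End⁰S` a totally
  real field of degree `dim S` (`t(S) = 3 dim S + 1`, `HodgeTheory/RealMultiplicationMumfordTateRank`); simple threefolds with a cubic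
  endomorphism field: `t(A × T) = t(A) + 9`, two non-isogenous ones `t = 19`.

## References
* [MoonenZarhin1999LowDim] B. Moonen, Yu. G. Zarhin, *Hodge classes on abelian varieties of low dimension*, Math. Ann. 315 (1999),
  §2 (2.2)–(2.3), §3 Lemma (3.4), §5 (5.4)–(5.5) [corpus: paper:arxiv-math_9901113 pp. 5–7, 9]. [cite: MoonenZarhin1999LowDim, §3 Lemma (3.4)]
* [Ribet1983] K. A. Ribet, *Hodge classes on certain types of abelian varieties*, Amer. J. Math. 105 (1983), Thm. 0–1. [cite: Ribet1983, Thm. 0–1]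
* [Murty1988] V. Kumar Murty, Proc. AMS 104 (1988), Thm. 2 (p. 67). [cite: Murty1988, Thm. 2 (p. 67)]
* [MumfordAV1970] D. Mumford, *Abelian Varieties* (1970), §19 Cor. 2 of Thm. 1, §21. [cite: MumfordAV1970, §19 Thm. 1 (pp. 173–174)]
-/

noncomputable section

open scoped TensorProduct
open CategoryTheory CategoryTheory.Limits Module NumberField

namespace Summit.HodgeConjecture.CorCM

open Literature.AlgebraicGeometry.Motives
open Literature.AlgebraicGeometry.Motives.AbelianVariety
open Literature.AlgebraicGeometry.Motives.HodgeStructure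
open Literature.AlgebraicGeometry.HodgeTheory
open Literature.AlgebraicGeometry.ComplexMultiplication
open Literature.AlgebraicGeometry.Milne1999 (IsOfCMType)
open Literature.NumberTheory.Automorphic (IsQuaternionAlgebra)

variable [HodgeTensorFacts.{0, 0}] {X : AbelianVariety ℂ} {n : ℕ}

/-! ## §3 Surfaces: every simple non-CM abelian surface; `t(A × S_RM) = t(A) + 6`; `RM × RM′ = 13` -/

/-- **`t(X) + 1 = t(A) + t(S)` for every `X ∼ A × S` with `S` a SIMPLE abelian SURFACE NOT of CM type and `Hom(A, S) = 0`** (`0 < dim A`,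
`A` arbitrary): `dim_ℚ End⁰S ∈ {1, 2, 4}` (`finrank_endAlgebra_eq_of_isSimple_surface`); `1` — `End⁰S = ℚ`, `Hg(S) = Sp₄`, the row of
`CorCM/MumfordTateRankTimesLowGeneric`; `2` — a REAL quadratic field (`isTotallyReal_endField_of_surface`), the Murty row; `4` non-commutative —
an indefinite quaternion algebra over `ℚ` (`isQuaternionAlgebra_endAlgebra_of_isSimple`), the quaternion row; `4` commutative is CM type, excluded.
Moonen–Zarhin (5.4): «if `dim(X₂) < 3` then `Hg(X) = Hg(X₁) × Hg(X₂)` follows from (2.4) and (3.4)».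
[cite: MoonenZarhin1999LowDim, §2 (2.2), §3 Lemma (3.4) and §5 (5.4)] [cite: MumfordAV1970, §19 Cor. 2 of Thm. 1 and §21] -/
theorem mtRank_hodge_one_add_one_eq_add_of_isIsogenous_prod_simpleSurface_of_not_isOfCMType (hX : IsSmoothProjective n X.X)
    {A S : AbelianVariety ℂ} {k l : ℕ} (hA : IsSmoothProjective k A.X) (hS : IsSmoothProjective l S.X) (hA0 : 0 < A.dim)
    (hSs : S.IsSimple) (hS2 : S.dim = 2) (hScm : ¬ IsOfCMType S) (hAS : ∀ u : A ⟶ S, u = 0) (hXP : IsIsogenous X (A.prod S)) :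
    haveI := BettiUniverse.finite hX 1
    haveI := BettiUniverse.finite hA 1
    haveI := BettiUniverse.finite hS 1
    (BettiUniverse.hodge exists_isReal_hodgeModel_holds hX 1).mtRank + 1 =
      (BettiUniverse.hodge exists_isReal_hodgeModel_holds hA 1).mtRank + (BettiUniverse.hodge exists_isReal_hodgeModel_holds hS 1).mtRank := by
  classical
  have hS0 : 0 < S.dim := by omega
  rcases AbelianVariety.finrank_endAlgebra_eq_of_isSimple_surface hSs hS2 with h1 | h2 | h4
  · exact mtRank_hodge_one_add_one_eq_add_of_isIsogenous_prod_endRankOne hX hA hS hA0 (Or.inr (Or.inl hS2)) h1 hAS hXP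
  · have hF : IsField S.endAlgebra := AbelianVariety.isField_endAlgebra_of_isSimple_of_finrank_eq_two hSs hS0 h2
    haveI : IsTotallyReal (EndField S hF) := AbelianVariety.isTotallyReal_endField_of_surface hS2 h2 hF
    exact mtRank_hodge_one_add_one_eq_add_of_isIsogenous_prod_isTotallyReal hX hA hS hA0 hF (by rw [h2, hS2]) hAS hXP
  · by_cases hcomm : ∀ x y : S.endAlgebra, x * y = y * x
    · exact absurd (isOfCMType_of_isSimple_surface_of_comm_of_finrank_eq_four hSs hS2 h4 hcomm) hScm
    · simp only [not_forall] at hcomm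
      obtain ⟨x, y, hxy⟩ := hcomm
      haveI : IsQuaternionAlgebra ℚ S.endAlgebra := AbelianVariety.isQuaternionAlgebra_endAlgebra_of_isSimple hSs hS0 h4 ⟨x, y, hxy⟩
      exact mtRank_hodge_one_add_one_eq_add_of_isIsogenous_prod_isSimple_quaternion hX hA hS hA0 hSs (K := ℚ)
        (by rw [Module.finrank_self, mul_one]; exact hS2) hAS hXP

/-- **`t(X) = t(A) + 6` for every `X ∼ A × S` with `S` a simple abelian surface with REAL MULTIPLICATION (`dim_ℚ End⁰S = 2`) and
`Hom(A, S) = 0`** (`t(S) = 7`: `Hg(S) = R_{F/ℚ} SL₂`, `CorCM/MumfordTateRankSimpleSurfacesSharp`). [cite: MoonenZarhin1999LowDim, §2 (2.2) and §3 Lemma (3.4)] -/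
theorem mtRank_hodge_one_eq_add_six_of_isIsogenous_prod_rmSurface (hX : IsSmoothProjective n X.X) {A S : AbelianVariety ℂ} {k : ℕ}
    (hA : IsSmoothProjective k A.X) (hA0 : 0 < A.dim) (hSs : S.IsSimple) (hS2 : S.dim = 2) (hSE : Module.finrank ℚ S.endAlgebra = 2)
    (hAS : ∀ u : A ⟶ S, u = 0) (hXP : IsIsogenous X (A.prod S)) :
    haveI := BettiUniverse.finite hX 1
    haveI := BettiUniverse.finite hA 1
    (BettiUniverse.hodge exists_isReal_hodgeModel_holds hX 1).mtRank = (BettiUniverse.hodge exists_isReal_hodgeModel_holds hA 1).mtRank + 6 := by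
  have hS : IsSmoothProjective S.dim S.X := AbelianVariety.isSmoothProjective_holds
  haveI := BettiUniverse.finite hX 1
  haveI := BettiUniverse.finite hA 1
  haveI := BettiUniverse.finite hS 1
  have hScm : ¬ IsOfCMType S := by
    rcases mtRank_hodge_one_of_isSimple_surface_sharp hS hSs hS2 with ⟨h1, -⟩ | ⟨-, -⟩ | ⟨h4, -, -, -⟩ | ⟨h4, -, -⟩
    · omega
    · intro hcm
      have h3 := (isOfCMType_iff_mtRank_hodge_one_eq_three_of_isSimple_surface hS hSs hS2).1 hcm
      rcases mtRank_hodge_one_of_isSimple_surface_sharp hS hSs hS2 with ⟨h1, -⟩ | ⟨-, h7⟩ | ⟨h4, -, -, -⟩ | ⟨h4, -, -⟩ <;> omega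
    · omega
    · omega
  have h7 : (BettiUniverse.hodge exists_isReal_hodgeModel_holds hS 1).mtRank = 7 := by
    rcases mtRank_hodge_one_of_isSimple_surface_sharp hS hSs hS2 with ⟨h1, -⟩ | ⟨-, h⟩ | ⟨h4, -, -, -⟩ | ⟨h4, -, -⟩
    · omega
    · exact h
    · omega
    · omega
  have h := mtRank_hodge_one_add_one_eq_add_of_isIsogenous_prod_simpleSurface_of_not_isOfCMType hX hA hS hA0 hSs hS2 hScm hAS hXP
  omega

/-- **`t(X) = t(A) + 3` for every `X ∼ A × S` with `S` a simple abelian surface with QUATERNIONIC MULTIPLICATION (`dim_ℚ End⁰S = 4`, not of CM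
type) and `Hom(A, S) = 0`** (`t(S) = 4`: `Hg(S) = U_{D^opp}`, a form of `SL₂`). [cite: MoonenZarhin1999LowDim, §2 (2.2) and §3 Lemma (3.4)] -/
theorem mtRank_hodge_one_eq_add_three_of_isIsogenous_prod_qmSurface (hX : IsSmoothProjective n X.X) {A S : AbelianVariety ℂ} {k : ℕ}
    (hA : IsSmoothProjective k A.X) (hA0 : 0 < A.dim) (hSs : S.IsSimple) (hS2 : S.dim = 2) (hSE : Module.finrank ℚ S.endAlgebra = 4)
    (hScm : ¬ IsOfCMType S) (hAS : ∀ u : A ⟶ S, u = 0) (hXP : IsIsogenous X (A.prod S)) :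
    haveI := BettiUniverse.finite hX 1
    haveI := BettiUniverse.finite hA 1
    (BettiUniverse.hodge exists_isReal_hodgeModel_holds hX 1).mtRank = (BettiUniverse.hodge exists_isReal_hodgeModel_holds hA 1).mtRank + 3 := by
  have hS : IsSmoothProjective S.dim S.X := AbelianVariety.isSmoothProjective_holds
  haveI := BettiUniverse.finite hX 1
  haveI := BettiUniverse.finite hA 1
  haveI := BettiUniverse.finite hS 1
  have h4 : (BettiUniverse.hodge exists_isReal_hodgeModel_holds hS 1).mtRank = 4 := by
    rcases mtRank_hodge_one_of_isSimple_surface_sharp hS hSs hS2 with ⟨h1, -⟩ | ⟨h2, -⟩ | ⟨-, -, hcm, -⟩ | ⟨-, -, h⟩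
    · omega
    · omega
    · exact absurd hcm hScm
    · exact h
  have h := mtRank_hodge_one_add_one_eq_add_of_isIsogenous_prod_simpleSurface_of_not_isOfCMType hX hA hS hA0 hSs hS2 hScm hAS hXP
  omega

/-- **Two NON-ISOGENOUS simple abelian surfaces with real multiplication: `t(S × S′) = 13`** (`Hg = R_{F/ℚ} SL₂ × R_{F′/ℚ} SL₂`, `t + 1 = 7 + 7`;
`Hom(S, S′) = 0` for non-isogenous simple varieties).  The `Θ`-rigid engine gave only `t ≤ 13` (Goursat's graph case for equal-dimensional factors);
Moonen–Zarhin's Lemma (3.4) excludes the graph. [cite: MoonenZarhin1999LowDim, §2 (2.2), §3 Lemma (3.4) and §5 (5.5)] -/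
theorem mtRank_hodge_one_eq_thirteen_of_isIsogenous_prod_rmSurfaces (hX : IsSmoothProjective n X.X) {S S' : AbelianVariety ℂ}
    (hSs : S.IsSimple) (hS2 : S.dim = 2) (hSE : Module.finrank ℚ S.endAlgebra = 2) (hS's : S'.IsSimple) (hS'2 : S'.dim = 2)
    (hS'E : Module.finrank ℚ S'.endAlgebra = 2) (hSS' : ¬ IsIsogenous S S') (hXP : IsIsogenous X (S.prod S')) :
    haveI := BettiUniverse.finite hX 1
    (BettiUniverse.hodge exists_isReal_hodgeModel_holds hX 1).mtRank = 13 := by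
  have hS : IsSmoothProjective S.dim S.X := AbelianVariety.isSmoothProjective_holds
  haveI := BettiUniverse.finite hX 1
  haveI := BettiUniverse.finite hS 1
  have h7 : (BettiUniverse.hodge exists_isReal_hodgeModel_holds hS 1).mtRank = 7 := by
    rcases mtRank_hodge_one_of_isSimple_surface_sharp hS hSs hS2 with ⟨h1, -⟩ | ⟨-, h⟩ | ⟨h4, -, -, -⟩ | ⟨h4, -, -⟩
    · omega
    · exact h
    · omega
    · omega
  have hHom : ∀ u : S ⟶ S', u = 0 := Literature.AlgebraicGeometry.Milne1999.hom_eq_zero_of_isSimple_of_not_isIsogenous hSs hS's hSS'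
  have h := mtRank_hodge_one_eq_add_six_of_isIsogenous_prod_rmSurface hX hS (by omega) hS's hS'2 hS'E hHom hXP
  omega

/-- **`t(S × S′) + 1 = t(S) + t(S′)` for every pair of NON-ISOGENOUS SIMPLE abelian SURFACES NOT of CM type** (the fourfold cells
`7 = 4+4−1`, `10`, `13`, `14`, `17`, `21` of the ladder, uniformly: Moonen–Zarhin (5.5) «`X ∼ X₁ × X₂` with `X₁` and `X₂` simple abelian surfaces
… `Hg(X) = Hg(X₁) × Hg(X₂)`»). [cite: MoonenZarhin1999LowDim, §3 Lemma (3.4) and §5 (5.5)] -/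
theorem mtRank_hodge_one_add_one_eq_add_of_isIsogenous_prod_simpleSurfaces_of_not_isOfCMType (hX : IsSmoothProjective n X.X)
    {S S' : AbelianVariety ℂ} {k l : ℕ} (hS : IsSmoothProjective k S.X) (hS' : IsSmoothProjective l S'.X) (hSs : S.IsSimple) (hS2 : S.dim = 2)
    (hS's : S'.IsSimple) (hS'2 : S'.dim = 2) (hS'cm : ¬ IsOfCMType S') (hSS' : ¬ IsIsogenous S S') (hXP : IsIsogenous X (S.prod S')) :
    haveI := BettiUniverse.finite hX 1
    haveI := BettiUniverse.finite hS 1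
    haveI := BettiUniverse.finite hS' 1
    (BettiUniverse.hodge exists_isReal_hodgeModel_holds hX 1).mtRank + 1 =
      (BettiUniverse.hodge exists_isReal_hodgeModel_holds hS 1).mtRank + (BettiUniverse.hodge exists_isReal_hodgeModel_holds hS' 1).mtRank :=
  mtRank_hodge_one_add_one_eq_add_of_isIsogenous_prod_simpleSurface_of_not_isOfCMType hX hS hS' (by omega) hS's hS'2 hS'cm
    (Literature.AlgebraicGeometry.Milne1999.hom_eq_zero_of_isSimple_of_not_isIsogenous hSs hS's hSS') hXP

/-! ## §4 Ribet's class: `End⁰S` a totally real field of degree `dim S` — `t(A × S) = t(A) + 3 dim S` -/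

/-- **`t(X) = t(A) + 3 dim S` for every `X ∼ A × S` with `End⁰S` a totally real field of degree `dim S` and `Hom(A, S) = 0`** (`0 < dim A`;
`t(S) = 3 dim S + 1`, Ribet: `MT(S) = 𝔾_m · R_{F/ℚ} SL_{2,F}`; with §2, `Hg(A × S) = Hg(A) × R_{F/ℚ} SL_{2,F}`).
[cite: Ribet1983, Thm. 0–1] [cite: MoonenZarhin1999LowDim, §2 (2.2) and §3 Lemma (3.4)] [cite: Murty1988, Thm. 2 (p. 67)] -/
theorem mtRank_hodge_one_eq_add_three_mul_dim_of_isIsogenous_prod_isTotallyReal (hX : IsSmoothProjective n X.X) {A S : AbelianVariety ℂ}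
    {k : ℕ} (hA : IsSmoothProjective k A.X) (hA0 : 0 < A.dim) (hF : IsField S.endAlgebra) [IsTotallyReal (EndField S hF)]
    (hdeg : Module.finrank ℚ S.endAlgebra = S.dim) (hAS : ∀ u : A ⟶ S, u = 0) (hXP : IsIsogenous X (A.prod S)) :
    haveI := BettiUniverse.finite hX 1
    haveI := BettiUniverse.finite hA 1
    (BettiUniverse.hodge exists_isReal_hodgeModel_holds hX 1).mtRank =
      (BettiUniverse.hodge exists_isReal_hodgeModel_holds hA 1).mtRank + 3 * S.dim := by
  have hS : IsSmoothProjective S.dim S.X := AbelianVariety.isSmoothProjective_holds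
  haveI := BettiUniverse.finite hX 1
  haveI := BettiUniverse.finite hA 1
  haveI := BettiUniverse.finite hS 1
  have h := mtRank_hodge_one_add_one_eq_add_of_isIsogenous_prod_isTotallyReal hX hA hS hA0 hF hdeg hAS hXP
  have h' := (mtRank_hodge_one_of_isTotallyReal' hF hS hdeg).1
  omega

/-- **`t(X) = t(A) + 9` for every `X ∼ A × T` with `T` a simple abelian THREEFOLD with a CUBIC endomorphism field (`dim_ℚ End⁰T = 3`: a
field since `T` is simple, totally real since of odd degree) and `Hom(A, T) = 0`** (`t(T) = 10`, `Hg(T) = R_{F/ℚ} SL₂`).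
[cite: Ribet1983, Thm. 0–1] [cite: MoonenZarhin1999LowDim, §2 (2.3) and §3 Lemma (3.4)] -/
theorem mtRank_hodge_one_eq_add_nine_of_isIsogenous_prod_threefold_of_finrank_endAlgebra_eq_three (hX : IsSmoothProjective n X.X)
    {A T : AbelianVariety ℂ} {k : ℕ} (hA : IsSmoothProjective k A.X) (hA0 : 0 < A.dim) (hTs : T.IsSimple) (hT3 : T.dim = 3)
    (hTE : Module.finrank ℚ T.endAlgebra = 3) (hAT : ∀ u : A ⟶ T, u = 0) (hXP : IsIsogenous X (A.prod T)) :
    haveI := BettiUniverse.finite hX 1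
    haveI := BettiUniverse.finite hA 1
    (BettiUniverse.hodge exists_isReal_hodgeModel_holds hX 1).mtRank = (BettiUniverse.hodge exists_isReal_hodgeModel_holds hA 1).mtRank + 9 := by
  have h0 : 0 < T.dim := by omega
  have hF : IsField T.endAlgebra := AbelianVariety.isField_endAlgebra_of_isSimple_of_finrank_eq_three hTs h0 hTE
  haveI : IsTotallyReal (EndField T hF) := AbelianVariety.isTotallyReal_endField_of_finrank_odd h0 hF (by rw [hTE]; decide)
  have h := mtRank_hodge_one_eq_add_three_mul_dim_of_isIsogenous_prod_isTotallyReal hX hA hA0 hF (by rw [hTE, hT3]) hAT hXP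
  omega

/-- **Two NON-ISOGENOUS simple abelian threefolds with cubic endomorphism fields: `t(T × T′) = 19`** (`t + 1 = 10 + 10`).
[cite: Ribet1983, Thm. 0–1] [cite: MoonenZarhin1999LowDim, §3 Lemma (3.4)] -/
theorem mtRank_hodge_one_eq_nineteen_of_isIsogenous_prod_threefolds_of_finrank_endAlgebra_eq_three (hX : IsSmoothProjective n X.X)
    {T T' : AbelianVariety ℂ} (hTs : T.IsSimple) (hT3 : T.dim = 3) (hTE : Module.finrank ℚ T.endAlgebra = 3) (hT's : T'.IsSimple)
    (hT'3 : T'.dim = 3) (hT'E : Module.finrank ℚ T'.endAlgebra = 3) (hTT' : ¬ IsIsogenous T T') (hXP : IsIsogenous X (T.prod T')) :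
    haveI := BettiUniverse.finite hX 1
    (BettiUniverse.hodge exists_isReal_hodgeModel_holds hX 1).mtRank = 19 := by
  have hT : IsSmoothProjective T.dim T.X := AbelianVariety.isSmoothProjective_holds
  haveI := BettiUniverse.finite hX 1
  haveI := BettiUniverse.finite hT 1
  have h10 := (mtRank_hodge_one_of_isSimple_threefold_of_finrank_endAlgebra_eq_three hT hTs hT3 hTE).1
  have h := mtRank_hodge_one_eq_add_nine_of_isIsogenous_prod_threefold_of_finrank_endAlgebra_eq_three hX hT (by omega) hT's hT'3 hT'E
    (Literature.AlgebraicGeometry.Milne1999.hom_eq_zero_of_isSimple_of_not_isIsogenous hTs hT's hTT') hXP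
  omega

end Summit.HodgeConjecture.CorCM

end
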